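import Summits.AtomisticToContinuum.Crystallization.Theorems.ThreeConeCertificateSlackRigidityRodLemmaB

/-!
# The 1-D spectral lemma of line `signed-root-silent-field` — part C: shrinking bumps

The registered stub `stub_rodLemma` (skeleton `Cruxes/SlackRigidity/Lines/signed-root-silent-field.lean`,
lead c2; crux `SlackRigidity`, stmt-AtomisticToContinuum-11960): a bounded sequence `u : ℤ → ℂ` with
`Σ_k u_k c(t − kh) = 0` for all real `t`, where `c` is continuous, `O((1+|t|)⁻²)`, and `𝓕c` is `C²`
and zero-free on `(1/(2h), 1/h) ∪ (−1/h, −1/(2h))`, is `2`-periodic.  Proof WITHOUT Wiener division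
or distributions: test the identity against `𝓕(φ/𝓕c)` (multiplication formula) to annihilate every
`C_c²` test function supported in a good interval; integer translates of the two good intervals cover
`ℝ ∖ ½ℤ`; shrinking bumps extend the annihilation to test functions with vanishing `2`-jets on `½ℤ`;
pairing with `𝐞(k₀·)(𝐞(2·) − 1)³ Q₀` (`𝓕Q₀|_ℤ = q δ₀`) gives a vanishing third difference of
`n ↦ u(k₀ + 2n)`, and a bounded sequence with vanishing third difference is constant.
All `[folklore]` (Rudin, *Functional Analysis* Thm 9.3; Katznelson, *Harmonic Analysis* Ch. VI).

This part: the fixed bump `χ` and its scaled translates `bumpAt N p`, the second derivative of a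
product, local smallness of a `C²` function at a point where its `2`-jet vanishes, and the
shrinking-bump estimate `∫‖θχ_{N,p}‖ + ∫‖(θχ_{N,p})''‖ → 0`.
-/

noncomputable section

open scoped BigOperators Topology FourierTransform Real
open MeasureTheory Filter Set Complex

namespace Summit.AtomisticToContinuum.Crystallization.Theorems.SignedRootRodLemma

section Bumps

/-- The fixed bump `χ`: smooth, `χ = 1` on `[−1, 1]`, `supp χ = (−2, 2)`, `0 ≤ χ ≤ 1`. [folklore] -/
def χ : ContDiffBump (0 : ℝ) := ⟨1, 2, one_pos, one_lt_two⟩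

/-- The bump as a real function. [folklore] -/
def χf : ℝ → ℝ := (χ : ℝ → ℝ)

/-- Its derivative. [folklore] -/
def χ' : ℝ → ℝ := deriv χf

/-- Its second derivative. [folklore] -/
def χ'' : ℝ → ℝ := deriv χ'

/-- `χ = 1` on `[−1, 1]`. [folklore] -/
theorem χf_eq_one {y : ℝ} (hy : |y| ≤ 1) : χf y = 1 :=
  χ.one_of_mem_closedBall (by simpa [χ] using hy)

/-- `χ = 0` off `(−2, 2)`. [folklore] -/
theorem χf_eq_zero {y : ℝ} (hy : 2 ≤ |y|) : χf y = 0 :=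
  χ.zero_of_le_dist (by simpa [χ] using hy)

/-- `|χ| ≤ 1`. [folklore] -/
theorem abs_χf_le (y : ℝ) : |χf y| ≤ 1 := by
  rw [χf, abs_of_nonneg χ.nonneg]; exact χ.le_one

/-- `χ` is `C²` (indeed smooth). [folklore] -/
theorem χf_contDiff : ContDiff ℝ 2 χf := χ.contDiff

/-- `χ'` is `C¹`. [folklore] -/
theorem χ'_contDiff : ContDiff ℝ 1 χ' := χf_contDiff.deriv'

/-- `χ` vanishes near every point with `|y| > 2`. [folklore] -/
theorem χf_eventuallyEq_zero {y : ℝ} (hy : 2 < |y|) : χf =ᶠ[𝓝 y] fun _ => 0 := by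
  have hopen : IsOpen {z : ℝ | 2 < |z|} := isOpen_lt continuous_const continuous_abs
  filter_upwards [hopen.mem_nhds hy] with z hz using χf_eq_zero (le_of_lt hz)

/-- `χ' = 0` where `|y| > 2`. [folklore] -/
theorem χ'_eq_zero {y : ℝ} (hy : 2 < |y|) : χ' y = 0 := by
  rw [χ', (χf_eventuallyEq_zero hy).deriv_eq]; exact deriv_const y 0

/-- `χ'' = 0` where `|y| > 2`. [folklore] -/
theorem χ''_eq_zero {y : ℝ} (hy : 2 < |y|) : χ'' y = 0 := by
  have hopen : IsOpen {z : ℝ | 2 < |z|} := isOpen_lt continuous_const continuous_abs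
  have h : χ' =ᶠ[𝓝 y] fun _ => 0 := by
    filter_upwards [hopen.mem_nhds hy] with z hz using χ'_eq_zero hz
  rw [χ'', h.deriv_eq]; exact deriv_const y 0

/-- Uniform bounds for `χ'` and `χ''`. [folklore] -/
theorem exists_bound_χ' :
    ∃ B₁ B₂ : ℝ, 0 ≤ B₁ ∧ 0 ≤ B₂ ∧ (∀ y, ‖χ' y‖ ≤ B₁) ∧ ∀ y, ‖χ'' y‖ ≤ B₂ := by
  have h1 : Continuous χ' := χf_contDiff.continuous_deriv (by norm_num)
  have h2 : Continuous χ'' := χ'_contDiff.continuous_deriv (by norm_num)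
  have hs1 : HasCompactSupport χ' := χ.hasCompactSupport.deriv
  have hs2 : HasCompactSupport χ'' := hs1.deriv
  obtain ⟨B₁, hB₁⟩ := hs1.exists_bound_of_continuous h1
  obtain ⟨B₂, hB₂⟩ := hs2.exists_bound_of_continuous h2
  exact ⟨B₁, B₂, (norm_nonneg _).trans (hB₁ 0), (norm_nonneg _).trans (hB₂ 0), hB₁, hB₂⟩

/-- The scaled, translated, complexified bump `x ↦ χ(N(x − p))`. [folklore] -/
def bumpAt (N : ℝ) (p : ℝ) (x : ℝ) : ℂ := ((χf (N * (x - p)) : ℝ) : ℂ)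

/-- First derivative of `bumpAt`. [folklore] -/
theorem hasDerivAt_bumpAt (N p x : ℝ) :
    HasDerivAt (bumpAt N p) ((N : ℂ) * ((χ' (N * (x - p)) : ℝ) : ℂ)) x := by
  have hχ : HasDerivAt χf (χ' (N * (x - p))) (N * (x - p)) :=
    ((χf_contDiff.differentiable (by norm_num)).differentiableAt).hasDerivAt
  have hlin : HasDerivAt (fun x : ℝ => N * (x - p)) (N * 1) x :=
    ((hasDerivAt_id x).sub_const p).const_mul N
  have h : HasDerivAt (fun y : ℝ => ((χf (N * (y - p)) : ℝ) : ℂ)) (((χ' (N * (x - p)) * (N * 1) : ℝ) : ℂ)) x :=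
    (hχ.comp x hlin).ofReal_comp
  have e : (((χ' (N * (x - p)) * (N * 1) : ℝ) : ℂ)) = (N : ℂ) * ((χ' (N * (x - p)) : ℝ) : ℂ) := by
    push_cast; ring
  rw [e] at h
  exact h

/-- `deriv bumpAt`. [folklore] -/
theorem deriv_bumpAt (N p : ℝ) :
    deriv (bumpAt N p) = fun x => (N : ℂ) * ((χ' (N * (x - p)) : ℝ) : ℂ) :=
  funext fun x => (hasDerivAt_bumpAt N p x).deriv

/-- Second derivative of `bumpAt`. [folklore] -/
theorem hasDerivAt_deriv_bumpAt (N p x : ℝ) :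
    HasDerivAt (deriv (bumpAt N p)) ((N : ℂ) ^ 2 * ((χ'' (N * (x - p)) : ℝ) : ℂ)) x := by
  rw [deriv_bumpAt]
  have hχ : HasDerivAt χ' (χ'' (N * (x - p))) (N * (x - p)) :=
    ((χ'_contDiff.differentiable (by norm_num)).differentiableAt).hasDerivAt
  have hlin : HasDerivAt (fun x : ℝ => N * (x - p)) (N * 1) x :=
    ((hasDerivAt_id x).sub_const p).const_mul N
  have h : HasDerivAt (fun y : ℝ => (N : ℂ) * ((χ' (N * (y - p)) : ℝ) : ℂ))
      ((N : ℂ) * (((χ'' (N * (x - p)) * (N * 1) : ℝ) : ℂ))) x :=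
    ((hχ.comp x hlin).ofReal_comp).const_mul (N : ℂ)
  have e : (N : ℂ) * (((χ'' (N * (x - p)) * (N * 1) : ℝ) : ℂ)) =
      (N : ℂ) ^ 2 * ((χ'' (N * (x - p)) : ℝ) : ℂ) := by
    push_cast; ring
  rw [e] at h
  exact h

/-- `deriv (deriv bumpAt)`. [folklore] -/
theorem deriv_deriv_bumpAt (N p : ℝ) :
    deriv (deriv (bumpAt N p)) = fun x => (N : ℂ) ^ 2 * ((χ'' (N * (x - p)) : ℝ) : ℂ) :=
  funext fun x => (hasDerivAt_deriv_bumpAt N p x).deriv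

/-- `bumpAt` is `C²`. [folklore] -/
theorem contDiff_bumpAt (N p : ℝ) : ContDiff ℝ 2 (bumpAt N p) := by
  have h1 : ContDiff ℝ 2 (fun x : ℝ => N * (x - p)) := contDiff_const.mul (contDiff_id.sub contDiff_const)
  exact (ofRealCLM.contDiff.of_le le_top).comp (χf_contDiff.comp h1)

/-- `‖bumpAt‖ ≤ 1`. [folklore] -/
theorem norm_bumpAt_le (N p x : ℝ) : ‖bumpAt N p x‖ ≤ 1 := by
  rw [bumpAt, Complex.norm_real, Real.norm_eq_abs]; exact abs_χf_le _

/-- `bumpAt = 1` on the closed ball of radius `1/N` (for `N > 0`). [folklore] -/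
theorem bumpAt_eq_one {N p x : ℝ} (hN : 0 < N) (hx : |x - p| ≤ 1 / N) : bumpAt N p x = 1 := by
  have h1 : |N * (x - p)| ≤ 1 := by
    rw [abs_mul, abs_of_pos hN]
    calc N * |x - p| ≤ N * (1 / N) := by gcongr
      _ = 1 := by field_simp
  rw [bumpAt, χf_eq_one h1, Complex.ofReal_one]

/-- `bumpAt`, `bumpAt'`, `bumpAt''` vanish where `|x − p| > 2/N` (for `N > 0`). [folklore] -/
theorem bumpAt_eq_zero {N p x : ℝ} (hN : 0 < N) (hx : 2 / N < |x - p|) :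
    bumpAt N p x = 0 ∧ deriv (bumpAt N p) x = 0 ∧ deriv (deriv (bumpAt N p)) x = 0 := by
  have h2 : 2 < |N * (x - p)| := by
    rw [abs_mul, abs_of_pos hN]
    have := (div_lt_iff₀ hN).1 hx
    linarith
  refine ⟨?_, ?_, ?_⟩
  · rw [bumpAt, χf_eq_zero h2.le, Complex.ofReal_zero]
  · rw [deriv_bumpAt]; simp [χ'_eq_zero h2]
  · rw [deriv_deriv_bumpAt]; simp [χ''_eq_zero h2]

/-- `bumpAt` vanishes where `|x − p| ≥ 2/N` (for `N > 0`). [folklore] -/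
theorem bumpAt_eq_zero_of_le {N p x : ℝ} (hN : 0 < N) (hx : 2 / N ≤ |x - p|) : bumpAt N p x = 0 := by
  have h2 : 2 ≤ |N * (x - p)| := by
    rw [abs_mul, abs_of_pos hN]
    have := (div_le_iff₀ hN).1 hx
    linarith
  rw [bumpAt, χf_eq_zero h2, Complex.ofReal_zero]

end Bumps

/-! ## Product rule, twice -/

/-- **Second derivative of a product** of two `C²` functions `ℝ → ℂ`. [folklore] -/
theorem deriv_deriv_mul {θ c : ℝ → ℂ} (hθ : ContDiff ℝ 2 θ) (hc : ContDiff ℝ 2 c) (x : ℝ) :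
    deriv (deriv (fun y => θ y * c y)) x =
      deriv (deriv θ) x * c x + 2 * (deriv θ x * deriv c x) + θ x * deriv (deriv c) x := by
  have hθ1 : Differentiable ℝ θ := hθ.differentiable (by norm_num)
  have hc1 : Differentiable ℝ c := hc.differentiable (by norm_num)
  have hθ2 : Differentiable ℝ (deriv θ) := hθ.differentiable_deriv_two
  have hc2 : Differentiable ℝ (deriv c) := hc.differentiable_deriv_two
  have h1 : deriv (fun y => θ y * c y) = fun y => deriv θ y * c y + θ y * deriv c y := by
    funext y
    exact ((hθ1 y).hasDerivAt.mul (hc1 y).hasDerivAt).deriv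
  rw [h1]
  have h2 : HasDerivAt (fun y => deriv θ y * c y + θ y * deriv c y)
      (deriv (deriv θ) x * c x + deriv θ x * deriv c x +
        (deriv θ x * deriv c x + θ x * deriv (deriv c) x)) x :=
    ((hθ2 x).hasDerivAt.mul (hc1 x).hasDerivAt).add ((hθ1 x).hasDerivAt.mul (hc2 x).hasDerivAt)
  rw [h2.deriv]
  ring

/-! ## Local smallness at a point where the 2-jet vanishes -/

/-- **Vanishing 2-jet ⇒ local smallness**: if `θ ∈ C²` has `θ(p) = θ'(p) = θ''(p) = 0`, then for
every `ε > 0` there is `δ > 0` with `‖θ''(x)‖ ≤ ε`, `‖θ'(x)‖ ≤ ε|x − p|`, `‖θ(x)‖ ≤ ε|x − p|²` for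
`|x − p| ≤ δ` (continuity of `θ''` and the mean value inequality, twice). [folklore] -/
theorem local_smallness {θ : ℝ → ℂ} (hθ : ContDiff ℝ 2 θ) {p : ℝ} (h0 : θ p = 0)
    (h1 : deriv θ p = 0) (h2 : deriv (deriv θ) p = 0) {ε : ℝ} (hε : 0 < ε) :
    ∃ δ : ℝ, 0 < δ ∧ ∀ x : ℝ, |x - p| ≤ δ →
      ‖deriv (deriv θ) x‖ ≤ ε ∧ ‖deriv θ x‖ ≤ ε * |x - p| ∧ ‖θ x‖ ≤ ε * |x - p| ^ 2 := by
  have hθ1 : Differentiable ℝ θ := hθ.differentiable (by norm_num)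
  have hθ2 : Differentiable ℝ (deriv θ) := hθ.differentiable_deriv_two
  have hθd : ContDiff ℝ 1 (deriv θ) := hθ.deriv'
  have hcont : Continuous (deriv (deriv θ)) := hθd.continuous_deriv (by norm_num)
  -- continuity of `θ''` at `p`
  obtain ⟨δ', hδ', hδ'b⟩ := Metric.continuous_iff.1 hcont p ε hε
  set δ : ℝ := δ' / 2 with hδ
  have hδpos : 0 < δ := by positivity
  have hbd2 : ∀ x, |x - p| ≤ δ → ‖deriv (deriv θ) x‖ ≤ ε := by
    intro x hx
    have hxd : dist x p < δ' := by
      rw [Real.dist_eq]; linarith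
    have := hδ'b x hxd
    rw [dist_eq_norm, h2, sub_zero] at this
    exact this.le
  -- mean value for `θ'` on balls about `p`
  have hbd1 : ∀ y, |y - p| ≤ δ → ‖deriv θ y‖ ≤ ε * |y - p| := by
    intro y hy
    have hconv : Convex ℝ (Metric.closedBall p |y - p|) := convex_closedBall _ _
    have hb : ∀ z ∈ Metric.closedBall p |y - p|, ‖deriv (deriv θ) z‖ ≤ ε := by
      intro z hz
      rw [Metric.mem_closedBall, Real.dist_eq] at hz
      exact hbd2 z (hz.trans hy)
    have hys : y ∈ Metric.closedBall p |y - p| := by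
      rw [Metric.mem_closedBall, Real.dist_eq]
    have := hconv.norm_image_sub_le_of_norm_deriv_le (fun z _ => (hθ2 z)) hb
      (Metric.mem_closedBall_self (abs_nonneg _)) hys
    rw [h1, sub_zero, Real.norm_eq_abs] at this
    exact this
  refine ⟨δ, hδpos, fun x hx => ⟨hbd2 x hx, hbd1 x hx, ?_⟩⟩
  -- mean value for `θ` on the ball of radius `|x - p|`
  have hconv : Convex ℝ (Metric.closedBall p |x - p|) := convex_closedBall _ _
  have hb : ∀ y ∈ Metric.closedBall p |x - p|, ‖deriv θ y‖ ≤ ε * |x - p| := by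
    intro y hy
    rw [Metric.mem_closedBall, Real.dist_eq] at hy
    exact (hbd1 y (hy.trans hx)).trans (mul_le_mul_of_nonneg_left hy hε.le)
  have hxs : x ∈ Metric.closedBall p |x - p| := by
    rw [Metric.mem_closedBall, Real.dist_eq]
  have := hconv.norm_image_sub_le_of_norm_deriv_le (fun y _ => (hθ1 y)) hb
    (Metric.mem_closedBall_self (abs_nonneg _)) hxs
  rw [h0, sub_zero, Real.norm_eq_abs] at this
  calc ‖θ x‖ ≤ ε * |x - p| * |x - p| := this
    _ = ε * |x - p| ^ 2 := by ring

/-! # PART C2b — the shrinking-bump estimate -/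

/-- `bumpAt N p` has compact support (for `N > 0`). [folklore] -/
theorem hasCompactSupport_bumpAt {N : ℝ} (hN : 0 < N) (p : ℝ) : HasCompactSupport (bumpAt N p) := by
  refine HasCompactSupport.intro (isCompact_closedBall p (2 / N)) fun x hx => ?_
  rw [Metric.mem_closedBall, Real.dist_eq, not_le] at hx
  exact bumpAt_eq_zero_of_le hN hx.le

/-- Integral of a function dominated by a constant on a closed ball and vanishing outside:
`∫ ‖f‖ ≤ c · 2r`. [folklore] -/
theorem integral_norm_le_of_le_indicator {f : ℝ → ℂ} (hf : Integrable f) {p r c : ℝ} (hr : 0 ≤ r)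
    (h : ∀ x, ‖f x‖ ≤ (Metric.closedBall p r).indicator (fun _ => c) x) :
    ∫ x, ‖f x‖ ≤ c * (2 * r) := by
  have hS : MeasurableSet (Metric.closedBall p r) := Metric.isClosed_closedBall.measurableSet
  have hint : Integrable ((Metric.closedBall p r).indicator fun _ : ℝ => c) := by
    refine IntegrableOn.integrable_indicator ?_ hS
    exact integrableOn_const (by rw [Real.volume_closedBall]; exact ENNReal.ofReal_ne_top)
  calc ∫ x, ‖f x‖ ≤ ∫ x, (Metric.closedBall p r).indicator (fun _ => c) x :=
        integral_mono hf.norm hint h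
    _ = (volume (Metric.closedBall p r)).toReal • c := integral_indicator_const c hS
    _ = c * (2 * r) := by
        rw [Real.volume_closedBall, ENNReal.toReal_ofReal (by linarith), smul_eq_mul, mul_comm]

/-- **The shrinking-bump estimate.**  If `θ ∈ C²` has vanishing `2`-jet at `p`, then
`∫‖θ·χ_{N,p}‖ + ∫‖(θ·χ_{N,p})''‖ → 0` as `N → ∞` (`χ_{N,p} = bumpAt N p`). [folklore] -/
theorem shrinking_bump {θ : ℝ → ℂ} (hθ : ContDiff ℝ 2 θ) {p : ℝ} (h0 : θ p = 0)
    (h1 : deriv θ p = 0) (h2 : deriv (deriv θ) p = 0) {ε : ℝ} (hε : 0 < ε) :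
    ∃ N₀ : ℕ, ∀ N : ℕ, N₀ ≤ N →
      (∫ x, ‖θ x * bumpAt N p x‖) + ∫ x, ‖deriv (deriv (fun y => θ y * bumpAt N p y)) x‖ ≤ ε := by
  obtain ⟨B₁, B₂, hB₁, hB₂, hb1, hb2⟩ := exists_bound_χ'
  set Kχ : ℝ := 1 + 4 * B₁ + 4 * B₂ with hKχ
  have hKχ0 : 0 < Kχ := by positivity
  set ε' : ℝ := ε / (2 + 2 * Kχ) with hε'
  have hε'0 : 0 < ε' := by positivity
  obtain ⟨δ, hδ, hsmall⟩ := local_smallness hθ h0 h1 h2 hε'0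
  -- choose `N₀` with `2/N₀ ≤ δ` and `N₀ ≥ 2`
  obtain ⟨N₁, hN₁⟩ := exists_nat_ge (2 / δ)
  refine ⟨max N₁ 2, fun N hN => ?_⟩
  have hN2 : (2 : ℝ) ≤ N := by exact_mod_cast (le_max_right N₁ 2).trans hN
  have hNpos : (0 : ℝ) < N := by linarith
  have hNδ : 2 / (N : ℝ) ≤ δ := by
    have hN1 : (N₁ : ℝ) ≤ N := by exact_mod_cast (le_max_left N₁ 2).trans hN
    rw [div_le_iff₀ hNpos]
    have := (div_le_iff₀ hδ).1 (hN₁.trans hN1)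
    linarith
  -- regularity of `g = θ · bump`
  set g : ℝ → ℂ := fun y => θ y * bumpAt N p y with hg
  have hbump : ContDiff ℝ 2 (bumpAt (N : ℝ) p) := contDiff_bumpAt _ _
  have hgd : ContDiff ℝ 2 g := hθ.mul hbump
  have hgs : HasCompactSupport g := (hasCompactSupport_bumpAt hNpos p).mul_left
  have hgi : Integrable g := hgd.continuous.integrable_of_hasCompactSupport hgs
  have hgd1 : ContDiff ℝ 1 (deriv g) := hgd.deriv'
  have hg2c : Continuous (deriv (deriv g)) := hgd1.continuous_deriv (by norm_num)
  have hg2s : HasCompactSupport (deriv (deriv g)) := hgs.deriv.deriv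
  have hg2i : Integrable (deriv (deriv g)) := hg2c.integrable_of_hasCompactSupport hg2s
  -- pointwise bounds by indicators of the ball of radius `2/N`
  have hr : (0 : ℝ) ≤ 2 / N := by positivity
  have hbound0 : ∀ x, ‖g x‖ ≤
      (Metric.closedBall p (2 / N)).indicator (fun _ => ε' * (2 / N) ^ 2) x := by
    intro x
    by_cases hx : x ∈ Metric.closedBall p (2 / N)
    · rw [Set.indicator_of_mem hx]
      have hx' : |x - p| ≤ 2 / N := by rwa [Metric.mem_closedBall, Real.dist_eq] at hx
      obtain ⟨-, -, hθ0⟩ := hsmall x (hx'.trans hNδ)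
      rw [hg]
      simp only [norm_mul]
      calc ‖θ x‖ * ‖bumpAt N p x‖ ≤ ε' * |x - p| ^ 2 * 1 := by
            gcongr
            exact norm_bumpAt_le _ _ _
        _ ≤ ε' * (2 / N) ^ 2 := by
            rw [mul_one]
            gcongr
    · rw [Set.indicator_of_notMem hx]
      have hx' : 2 / (N : ℝ) < |x - p| := by
        rwa [Metric.mem_closedBall, Real.dist_eq, not_le] at hx
      rw [hg]
      simp only
      rw [(bumpAt_eq_zero hNpos hx').1, mul_zero, norm_zero]
  have hbound2 : ∀ x, ‖deriv (deriv g) x‖ ≤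
      (Metric.closedBall p (2 / N)).indicator (fun _ => ε' * Kχ) x := by
    intro x
    rw [hg, deriv_deriv_mul hθ hbump x]
    by_cases hx : x ∈ Metric.closedBall p (2 / N)
    · rw [Set.indicator_of_mem hx]
      have hx' : |x - p| ≤ 2 / N := by rwa [Metric.mem_closedBall, Real.dist_eq] at hx
      obtain ⟨hθ2, hθ1, hθ0⟩ := hsmall x (hx'.trans hNδ)
      rw [deriv_deriv_bumpAt, deriv_bumpAt]
      simp only
      have e1 : ‖(N : ℂ) * ((χ' (N * (x - p)) : ℝ) : ℂ)‖ ≤ N * B₁ := by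
        rw [norm_mul, Complex.norm_natCast, Complex.norm_real]
        gcongr
        exact hb1 _
      have e2 : ‖(N : ℂ) ^ 2 * ((χ'' (N * (x - p)) : ℝ) : ℂ)‖ ≤ N ^ 2 * B₂ := by
        rw [norm_mul, norm_pow, Complex.norm_natCast, Complex.norm_real]
        gcongr
        exact hb2 _
      have hxN : |x - p| * N ≤ 2 := by
        have := (le_div_iff₀ hNpos).1 hx'
        linarith
      calc ‖deriv (deriv θ) x * bumpAt N p x + 2 * (deriv θ x * ((N : ℂ) * ((χ' (N * (x - p)) : ℝ) : ℂ))) +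
              θ x * ((N : ℂ) ^ 2 * ((χ'' (N * (x - p)) : ℝ) : ℂ))‖
          ≤ ‖deriv (deriv θ) x * bumpAt N p x‖ + ‖2 * (deriv θ x * ((N : ℂ) * ((χ' (N * (x - p)) : ℝ) : ℂ)))‖ +
              ‖θ x * ((N : ℂ) ^ 2 * ((χ'' (N * (x - p)) : ℝ) : ℂ))‖ := norm_add₃_le
        _ ≤ ε' * 1 + 2 * ((ε' * |x - p|) * (N * B₁)) + (ε' * |x - p| ^ 2) * (N ^ 2 * B₂) := by
            gcongr
            · rw [norm_mul]; gcongr; exact norm_bumpAt_le _ _ _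
            · rw [norm_mul, norm_mul, Complex.norm_two]
              gcongr
            · rw [norm_mul]; gcongr
        _ = ε' * (1 + 2 * (|x - p| * N) * B₁ + (|x - p| * N) ^ 2 * B₂) := by ring
        _ ≤ ε' * (1 + 2 * 2 * B₁ + 2 ^ 2 * B₂) := by
            gcongr
        _ = ε' * Kχ := by rw [hKχ]; ring
    · rw [Set.indicator_of_notMem hx]
      have hx' : 2 / (N : ℝ) < |x - p| := by
        rwa [Metric.mem_closedBall, Real.dist_eq, not_le] at hx
      obtain ⟨e0, e1, e2⟩ := bumpAt_eq_zero hNpos hx'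
      rw [e0, e1, e2]
      simp
  -- integrate
  have hI0 := integral_norm_le_of_le_indicator hgi hr hbound0
  have hI2 := integral_norm_le_of_le_indicator hg2i hr hbound2
  have hsmallN : (2 / (N : ℝ)) ^ 2 * (2 * (2 / N)) ≤ 2 := by
    have h1 : 2 / (N : ℝ) ≤ 1 := by rw [div_le_one hNpos]; exact hN2
    have h0 : 0 ≤ 2 / (N : ℝ) := hr
    nlinarith [mul_le_mul h1 h1 h0 zero_le_one]
  have hsmallN' : 2 * (2 / (N : ℝ)) ≤ 2 := by
    have h1 : 2 / (N : ℝ) ≤ 1 := by rw [div_le_one hNpos]; exact hN2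
    linarith
  calc (∫ x, ‖θ x * bumpAt N p x‖) + ∫ x, ‖deriv (deriv g) x‖
      ≤ ε' * (2 / N) ^ 2 * (2 * (2 / N)) + ε' * Kχ * (2 * (2 / N)) := add_le_add hI0 hI2
    _ = ε' * ((2 / N) ^ 2 * (2 * (2 / N))) + ε' * Kχ * (2 * (2 / N)) := by ring
    _ ≤ ε' * 2 + ε' * Kχ * 2 := by gcongr
    _ = ε := by rw [hε']; field_simp

/-- Anchor of this helper file (registered obligation): the bumps are bounded by `1`. [folklore] -/
theorem rodLemmaC_anchor : ∀ N p x : ℝ, ‖bumpAt N p x‖ ≤ 1 := norm_bumpAt_le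

end Summit.AtomisticToContinuum.Crystallization.Theorems.SignedRootRodLemma

end
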